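import Summits.QuantumFields.YangMills.Theorems.BalabanUVNodesN06TbHLegAtPinsPhysPUPar

/-!
# BalabanUVNodes ∕ N06 ([B9], `Dag.B9_main`) — R1 J-TWIN (STATE MACHINERY 1∕5): THE T_b LETTER INTO THE HÖLDER CLASS `bH13` AT A PARAMETRIC SITE
# TRANSPORTER, ALONG A SUB-FAMILY `f : J → MemberY …` — the J-twin of ✓`…N06TbHLegAtPinsPhysPUPar.htbH_of_pinsP43_geo9Y_par` (dag-n06-d g26, CASCADE-K «K3-D»)

Track A of `YM-PLAN.md` (cell `pub-ymgap`, HUMAN RULING D-0062), node **N06** = [Balaban1985BackgroundPropagators]; IR-N06-SECTION-2 road **R1** («J-twin of the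
producer cone», ★★★ director-ym №524 (3): authorised in principle, STAGED, sibling files only), `R1-JTWIN-SPEC.md` rule (R)′ (dag-n06-d, 2026-08-31): re-key EXACTLY
the section-tainted ∀-member rows along `f`, keep data ∕ pins ∕ laws ∕ section-free rows member-wide, tainted conclusions along `f` ((R).3′).
Seat `pub-ymgap-dag-n06-d` g30 — the STATE-MACHINERY layer under dag-n06-l's (7)ᴶ ∕ (10)ᴶ ∕ L1ᴶ (their memo `R1-PATH-CENSUS-MEMO.md` §7–§8: the rows required J-keyed
from `…N06StateLayerAtPinsPUWPar.hStateTuplesW_of_pinsP_geo9Y_par` are `{h49, hta, hD2}`); this file is the first of its four leaf feeders.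

WHAT.  `htbH_of_pinsP43_geo9Y_par_J` = the parent's theorem with `{J : Type} (f : J → MemberY d ℓ hd hL b₀ b₁ Mstar)` added after the `H` binder and
* TAINTED ROW OF THIS TWIN: `h49` — print's (3.49) majorant for the renormalisation projection `P` (⟸ (3.48) rows 15∕16 `h348` through
  `…N06Proj349AtPinsPhysRCPar`), re-keyed `∀ x : MemberY … ↦ ∀ j : J`, read at `f j`;
* LEFT member-wide: the letter families `bH13 𝔬12 Gp parS`, the pins `hbH13 hblk12 hblkW12 hGp hparS`, the block-map laws `hlev hβ1`, the regularity class `hGR`,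
  Theorem 3.1 `h31`, the (3.43) display `h43` (section-free rows), all x-free numerics ∕ rates ∕ budgets; the per-member inputs `hBJx htax` (current letters, T_a) stay
  hypotheses AFTER `U` exactly as in the parent;
* conclusion `∃ MT, ∀ j : J, MT ≤ (geo9Y (f j)).M → …` — the parent's T_b majorant into `bH13 (f j) U`, along `f`.
PROOF: the parent's text by generator (`mkJ.py`, dag-n06-l g41's, over the tree bytes): the ∃-threshold `max M₀ (max Mg ML)` is x-free (member-wide Literature facts
`facts347_exp261_geo9Y`, `rowConst261_spec_of_rowSum261`); the pointwise body `fun x ↦ fun j`, member reads `x ↦ f j`, `h49 x ↦ h49 j`; nothing re-derived.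
The member-wide parent is the instance `J := MemberY …`, `f := id`.  ORPHAN by design until `…N06StateLayerAtPinsPUWParJ` lands (honest).
HONEST FRAMING.  Bookkeeping over landed objects; (3.49), Theorem 3.1, (3.43), the current letters and T_a are HYPOTHESES; nothing of [B9] ∕ [4] asserted; COUNT-NEUTRAL
(`--supports stmt-QuantumFields-27239 --as helper`); N06 NOT discharged; K1 NOT closed; under R1 the inner-corner question stays DISPLAYED at the K1 face ∕ NODE O join
by (α5); nothing continuum ∕ OS ∕ mass gap ∕ Clay.  0 `def`, 0 `sorry`.  NEW file; the parent untouched.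
[cite: Balaban1985BackgroundPropagators, Thm 3.3 p.399, (3.43) p.397, (3.49) p.398, (3.130)–(3.131) pp.421–422, (3.151)–(3.153) p.426;
Balaban1984PropagatorsII, (2.51)–(2.54) pp.232–233, Lemma 2.1 (2.60)–(2.61) p.234]
-/

noncomputable section

namespace Summit.QuantumFields.YangMills.BalabanUVNodes.N06TbHLegAtPinsPhysPUParJ

open Literature.MathematicalPhysics.QuantumFieldTheory.Balaban1983to89
open Literature.MathematicalPhysics.QuantumFieldTheory.Balaban1983to89.Node00 (FBondY IBondY SiteY CfgY SiteParY SiteOpY BondParY parSymY parBY GpY GpPhysY)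
open Literature.MathematicalPhysics.QuantumFieldTheory.Balaban1983to89.Node00.OpsYSectDCoords (DvcoKH DvscoKH RcoK cR39_trBasis_pos)
open Literature.MathematicalPhysics.QuantumFieldTheory.Balaban1983to89.B9Thm39ReadingCoords (cR39)
open Literature.MathematicalPhysics.QuantumFieldTheory.Balaban1983to89.B9Thm34Ext (toB6)
open Literature.MathematicalPhysics.QuantumFieldTheory.Balaban1983to89.B11SectG (HasMaj BlockNorm RowSum)
open Literature.MathematicalPhysics.QuantumFieldTheory.Balaban1983to89.B9Thm312Whole (cNorm GeoOK)
open Literature.MathematicalPhysics.QuantumFieldTheory.Balaban1983to89.B9Thm312WholeClasses (cNormR)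
open Literature.MathematicalPhysics.QuantumFieldTheory.Balaban1983to89.B9RWSums343Holder (HolderProbes)
open Literature.MathematicalPhysics.QuantumFieldTheory.Balaban1983to89.B9RWSums343to347Whole (Facts347)
open Literature.MathematicalPhysics.QuantumFieldTheory.Balaban1983to89.B9CoReadingCoords (XBK blkBK)
open Literature.MathematicalPhysics.QuantumFieldTheory.Balaban1983to89.B9CoReadingCoordsS (XSK sIK blkSK GcoS)
open Literature.MathematicalPhysics.QuantumFieldTheory.Balaban1983to89.B9CoReadingCoordsH (XHK)
open Literature.MathematicalPhysics.QuantumFieldTheory.Balaban1983to89.B9CoReadingCoordsHolder (PK)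
open Literature.MathematicalPhysics.QuantumFieldTheory.Balaban1983to89.B9CoReadingCoordsTranspose (TrIdx trBasis)
open Literature.MathematicalPhysics.QuantumFieldTheory.Balaban1983to89.B9PinMembersKLevelV1 (MemberY geo9Y)
open Literature.MathematicalPhysics.QuantumFieldTheory.Balaban1983to89.B9BackgroundsKLevelV1R (RegFamY bg9YR MemOfFam)
open Literature.MathematicalPhysics.QuantumFieldTheory.Balaban1983to89.B9GeoLemma21KLevelV1 (geo9Y_len_pos geo9Y_dist_triangle geo9Y_dist_comm)
open Literature.MathematicalPhysics.QuantumFieldTheory.Balaban1983to89.B9GeoNormsKLevelV1 (geo9K geo9K_dist_nonneg)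
open Literature.MathematicalPhysics.QuantumFieldTheory.Balaban1983to89.B7Prop2SpecialUnitary (specialUnitaryUnits)
open Literature.MathematicalPhysics.QuantumFieldTheory.Balaban1983to89.B9PerturbationMajorantAlgebra (Proj349Maj)
open Literature.MathematicalPhysics.QuantumFieldTheory.Balaban1983to89.B9PerturbationMajorantsAtLetters (PcoK rcoK_eq)
open Literature.MathematicalPhysics.QuantumFieldTheory.Balaban1983to89.B9PerturbationMajorantsAtLettersPhys (rcoK_GpPhysY)
open Literature.MathematicalPhysics.QuantumFieldTheory.Balaban1983to89.B9MultiscaleSmoothPartitionYNear (rNear)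
open Literature.MathematicalPhysics.QuantumFieldTheory.Balaban1983to89.B9SmoothHolderClassP (bHZKP bHZKPG)
open Literature.MathematicalPhysics.QuantumFieldTheory.Balaban1983to89.B9GradViaDivLettersTransported (taxiB)
open Literature.MathematicalPhysics.QuantumFieldTheory.Balaban1983to89.B9Thm313WholeHolderProducersAtPinsPrint (tbH_pins_print_of_h43)
open Literature.MathematicalPhysics.QuantumFieldTheory.Balaban1983to89.B9PerturbationMajorantAlgebra (CurrentMaj)
open Literature.MathematicalPhysics.QuantumFieldTheory.Balaban1983to89.B9PerturbationMajorantsAtLetters (BcoKH BdcoKH)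
open Literature.MathematicalPhysics.QuantumFieldTheory.Balaban1983to89.B9PerturbationSplitAtLetters (TaLcoK TbLcoKH)
open Literature.MathematicalPhysics.QuantumFieldTheory.Balaban1983to89.B9SmoothHolderClassPProducers (CTel CTel_nonneg CTel_mono)
open Literature.MathematicalPhysics.QuantumFieldTheory.Balaban1983to89.B9PerturbationMajorantAlgebra (hasMaj_weaken)
open Literature.MathematicalPhysics.QuantumFieldTheory.Balaban1983to89.B9Thm313WholeRgdFrom3152 (Ids3152)
open Literature.MathematicalPhysics.QuantumFieldTheory.Balaban1983to89.B9SmoothHolderClassP (bHZPG)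
open Literature.MathematicalPhysics.QuantumFieldTheory.Balaban1983to89.B9GradViaDivLettersTransported (taxiS)
open Literature.MathematicalPhysics.QuantumFieldTheory.Balaban1983to89.B9SmoothHolderClassTClosure (abs_cf_eq_nKT)
open Literature.MathematicalPhysics.QuantumFieldTheory.Balaban1983to89.B9RWSums347DefiniteFaces (geo9Y_scalars)
open Summit.QuantumFields.YangMills.BalabanUVNodes.N06HolderPinsGradedAtRecord (links_le_one)
open B6Prop22KLevelTorusCensusEta (nKT) open Literature.MathematicalPhysics.QuantumFieldTheory.Balaban1983to89.Node00 (toKT)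
open Literature.MathematicalPhysics.QuantumFieldTheory.Balaban1983to89.B9RWSums347DefiniteFaces (exp261 facts347_exp261_geo9Y)
open Literature.MathematicalPhysics.QuantumFieldTheory.Balaban1983to89.B9RowSum261DefiniteFaces (rowConst261 rowConst261_nonneg rowConst261_spec_of_rowSum261)
open Literature.MathematicalPhysics.QuantumFieldTheory.Balaban1983to89.B9GeoLemma21KLevelV1 (rowSum261_geo9Y)
open Literature.MathematicalPhysics.QuantumFieldTheory.Balaban1983to89.B9SectDSup (weightNorm)
open Literature.MathematicalPhysics.QuantumFieldTheory.Balaban1983to89.B6RandomWalkHom (HasMajorantHom)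
open Literature.MathematicalPhysics.QuantumFieldTheory.Balaban1983to89.B9Thm313WholeLettersCut (Letters313Zc)
open Literature.MathematicalPhysics.QuantumFieldTheory.Balaban1983to89.B9PerturbationMajorantAlgebra (Thm31GpMaj)
open Literature.MathematicalPhysics.QuantumFieldTheory.Balaban1983to89.B9Thm312Whole (Identities)
open Literature.MathematicalPhysics.QuantumFieldTheory.Balaban1983to89.B9CoReadingCoordsHolder (blkPK probeK wK w₀K)
open Literature.MathematicalPhysics.QuantumFieldTheory.Balaban1983to89.B9CoReadingCoordsHolderAdm (wKA holderProbesKA)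
open Literature.MathematicalPhysics.QuantumFieldTheory.Balaban1983to89.B9LettersHZAtOne (plateau_pos)
open B6GlobalChartV1 (PV blkV1) open B6Ineq2142KLevelV1 (β lvl) open B6Geom246MultiLevelTorus (geomT)
open scoped Matrix.Norms.L2Operator

variable {N : ℕ} {d ℓ : ℕ} {hd : 1 ≤ d + 1} {hL : Odd (ℓ + 1) ∧ 1 < ℓ + 1} {b₀ b₁ : ℝ} {Mstar : ℕ}

/-- ★★ **THE T_b LETTER INTO `bH13 x U` DERIVED ABOVE A CLOSED THRESHOLD AT THE PRINT-WEIGHTED PIN (P2′), PRINT'S ROUTE, NO Δ⁽²⁾ INPUT** (module docstring). [cite: Balaban1985BackgroundPropagators, (3.130)–(3.131) pp.421–422 + (3.135)–(3.137) pp.422–423 + Thm 3.1 (3.42)–(3.43) pp.397–398 + (3.49) p.399 + (3.152) p.426; Balaban1984PropagatorsII, (2.51)–(2.56) pp.232–233 + Lemma 2.1 (2.59)–(2.61) pp.233–234] -/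
theorem htbH_of_pinsP43_geo9Y_par_J
    (parT : ∀ i : B6KLevelCensusIndexV1.KIdx d ℓ hd hL b₀ b₁, Node00.SiteParY (Matrix (Fin N) (Fin N) ℂ) i) [NeZero N] [∀ x : MemberY d ℓ hd hL b₀ b₁ Mstar, Fintype (geo9Y x).Site]
    {R₁ R₂ : RegFamY d ℓ hd hL b₀ b₁ Mstar (Matrix (Fin N) (Fin N) ℂ)} (H : MemberY d ℓ hd hL b₀ b₁ Mstar → Prop) {J : Type} (f : J → MemberY d ℓ hd hL b₀ b₁ Mstar)
    (bI : ∀ x : MemberY d ℓ hd hL b₀ b₁ Mstar, FBondY x.toKIdx → IBondY x.toKIdx)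
    (hlev : ∀ (x : MemberY d ℓ hd hL b₀ b₁ Mstar) (f : FBondY x.toKIdx), lvl x.hN x.D x.hk (bI x f) = (blkV1 x.hN x.D f).1.1)
    (hβ1 : ∀ (x : MemberY d ℓ hd hL b₀ b₁ Mstar) (f : FBondY x.toKIdx), (geomT x.D).dist (β x.hN x.D x.hk (bI x f)) (blkV1 x.hN x.D f) ≤ 1)
    (hGR : MemOfFam (specialUnitaryUnits (Fin N)) R₁) (c : ℝ) {M₀ a₀ : ℝ} (hM₀ : 0 ≤ M₀) {σ τ : ℝ} (hσ : 0 < σ) (hτ : 0 < τ)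
    (w13 : ℝ → ℝ) (hw13₀ : ∀ s, 0 ≤ w13 s) (hw13₁ : ∀ s, w13 s ≤ 1)
    (bH13 : ∀ x : MemberY d ℓ hd hL b₀ b₁ Mstar, (bg9YR (Matrix (Fin N) (Fin N) ℂ) (specialUnitaryUnits (Fin N)) R₁ R₂ x).Cfg → BlockNorm (toB6 (geo9Y x) 1 (H x)) (XSK (TrIdx N) x.toKIdx → ℝ))
    (hbH13 : ∀ (x : MemberY d ℓ hd hL b₀ b₁ Mstar) (U : (bg9YR (Matrix (Fin N) (Fin N) ℂ) (specialUnitaryUnits (Fin N)) R₁ R₂ x).Cfg), bH13 x U =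
      letI : Fintype (geo9K x.toKIdx).Site := (inferInstance : Fintype (geo9Y x).Site);
      bHZPG (κ := TrIdx N) x.toKIdx (trBasis N) (taxiS x.toKIdx (bg9YR (Matrix (Fin N) (Fin N) ℂ) (specialUnitaryUnits (Fin N)) R₁ R₂ x) (fun U => U) U) (R := (1 : ℝ)) (H := H x) w13 hw13₀ hw13₁)
    (𝔬12 : ∀ x : MemberY d ℓ hd hL b₀ b₁ Mstar, B9Thm312Whole.Ops (geo9Y x) (bg9YR (Matrix (Fin N) (Fin N) ℂ) (specialUnitaryUnits (Fin N)) R₁ R₂ x) (XBK (TrIdx N) x.toKIdx) (XBK (TrIdx N) x.toKIdx) (XHK (TrIdx N) x.toKIdx) (XSK (TrIdx N) x.toKIdx))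
    (hblk12 : ∀ x : MemberY d ℓ hd hL b₀ b₁ Mstar, (𝔬12 x).blk = blkBK x.toKIdx (bI x))
    (hblkW12 : ∀ x : MemberY d ℓ hd hL b₀ b₁ Mstar, (𝔬12 x).blkW = blkSK x.toKIdx (sIK x.toKIdx (bI x)))
    {B₀ δ₀ CP δP tJ δB B43 δ43 tA δT r ρ : ℝ} (hB₀ : 0 ≤ B₀) (hCP : 0 ≤ CP) (htJ : 0 ≤ tJ) (hB43 : 0 ≤ B43) (htA : 0 ≤ tA)
    (hr₀ : r ≤ δ₀) (hrP : r ≤ δP) (hrB : r ≤ δB) (hρ : 0 ≤ ρ) (hρT : ρ ≤ δT) (hbud : ρ + σ + τ ≤ r) (hbud43 : ρ + σ ≤ δ43) {t₂ : ℝ}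
    (ht₂ : ((CTel d ℓ (trBasis N) ρ (B₀ * (((ℓ + 1 : ℕ) : ℝ)) * ((cR39 (trBasis N))⁻¹ * (tJ * (((ℓ + 1 : ℕ) : ℝ)) ^ 2)) * rowConst261 (@geo9Y d ℓ hd hL b₀ b₁ Mstar) σ) (B₀ * (((ℓ + 1 : ℕ) : ℝ)) * ((cR39 (trBasis N))⁻¹ * (tJ * (((ℓ + 1 : ℕ) : ℝ)) ^ 2)) * rowConst261 (@geo9Y d ℓ hd hL b₀ b₁ Mstar) σ) + CTel d ℓ (trBasis N) ρ (CP * (((ℓ + 1 : ℕ) : ℝ)) * (B₀ * (((ℓ + 1 : ℕ) : ℝ)) * ((cR39 (trBasis N))⁻¹ * (tJ * (((ℓ + 1 : ℕ) : ℝ)) ^ 2)) * rowConst261 (@geo9Y d ℓ hd hL b₀ b₁ Mstar) σ) * rowConst261 (@geo9Y d ℓ hd hL b₀ b₁ Mstar) σ) (CP * (((ℓ + 1 : ℕ) : ℝ)) * (B₀ * (((ℓ + 1 : ℕ) : ℝ)) * ((cR39 (trBasis N))⁻¹ * (tJ * (((ℓ + 1 : ℕ) : ℝ)) ^ 2)) *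 rowConst261 (@geo9Y d ℓ hd hL b₀ b₁ Mstar) σ) * rowConst261 (@geo9Y d ℓ hd hL b₀ b₁ Mstar) σ)) + (B43 * ((cR39 (trBasis N))⁻¹ * tA) * rowConst261 (@geo9Y d ℓ hd hL b₀ b₁ Mstar) σ + CTel d ℓ (trBasis N) ρ (CP * (((ℓ + 1 : ℕ) : ℝ)) * (B₀ * ((cR39 (trBasis N))⁻¹ * tA) * rowConst261 (@geo9Y d ℓ hd hL b₀ b₁ Mstar) σ) * rowConst261 (@geo9Y d ℓ hd hL b₀ b₁ Mstar) σ) (CP * (((ℓ + 1 : ℕ) : ℝ)) * (B₀ * ((cR39 (trBasis N))⁻¹ * tA) * rowConst261 (@geo9Y d ℓ hd hL b₀ b₁ Mstar) σ) * rowConst261 (@geo9Y d ℓ hd hL b₀ b₁ Mstar) σ)) + (B43 * ((cR39 (trBasis N))⁻¹ * tA) * rowConst261 (@geo9Y d ℓ hd hL b₀ b₁ Mstar) σ + CTel d ℓ (trBasis N) ρ (CP * (((ℓ + 1 : ℕ) : ℝ)) * (B₀ * ((cR39 (trBasis N))⁻¹ * tA) * rowConst261 (@geo9Y d ℓ hd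 hL b₀ b₁ Mstar) σ) * rowConst261 (@geo9Y d ℓ hd hL b₀ b₁ Mstar) σ) (CP * (((ℓ + 1 : ℕ) : ℝ)) * (B₀ * ((cR39 (trBasis N))⁻¹ * tA) * rowConst261 (@geo9Y d ℓ hd hL b₀ b₁ Mstar) σ) * rowConst261 (@geo9Y d ℓ hd hL b₀ b₁ Mstar) σ))) ≤ t₂)
    {Gp : ∀ x : MemberY d ℓ hd hL b₀ b₁ Mstar, SiteOpY (Matrix (Fin N) (Fin N) ℂ) x.toKIdx} (hGp : ∀ x : MemberY d ℓ hd hL b₀ b₁ Mstar, Gp x = GpY x.toKIdx (parT x.toKIdx))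
    {parS : ∀ x : MemberY d ℓ hd hL b₀ b₁ Mstar, SiteParY (Matrix (Fin N) (Fin N) ℂ) x.toKIdx} (hparS : ∀ x : MemberY d ℓ hd hL b₀ b₁ Mstar, parS x = parT x.toKIdx)
    (h31 : ∀ x : MemberY d ℓ hd hL b₀ b₁ Mstar, M₀ ≤ (geo9Y x).M → ∀ α₀ : ℝ, 0 < α₀ → (geo9Y x).M * α₀ ≤ a₀ → ∀ U : (bg9YR (Matrix (Fin N) (Fin N) ℂ) (specialUnitaryUnits (Fin N)) R₁ R₂ x).Cfg, (bg9YR (Matrix (Fin N) (Fin N) ℂ) (specialUnitaryUnits (Fin N)) R₁ R₂ x).Reg335 c α₀ U →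
      Thm31GpMaj (g := geo9Y x) (blkSK x.toKIdx (sIK x.toKIdx (bI x))) (blkBK x.toKIdx (bI x))
        (GcoS x.toKIdx (trBasis N) (bg9YR (Matrix (Fin N) (Fin N) ℂ) (specialUnitaryUnits (Fin N)) R₁ R₂ x) (fun U => U) (Gp x) U)
        (DvcoKH x.toKIdx (trBasis N) (bg9YR (Matrix (Fin N) (Fin N) ℂ) (specialUnitaryUnits (Fin N)) R₁ R₂ x) (fun U => U) U) (DvscoKH x.toKIdx (trBasis N) (bg9YR (Matrix (Fin N) (Fin N) ℂ) (specialUnitaryUnits (Fin N)) R₁ R₂ x) (fun U => U) U) 1 (H x) B₀ δ₀)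
    (h49 : ∀ j : J, M₀ ≤ (geo9Y (f j)).M → ∀ α₀ : ℝ, 0 < α₀ → (geo9Y (f j)).M * α₀ ≤ a₀ → ∀ U : (bg9YR (Matrix (Fin N) (Fin N) ℂ) (specialUnitaryUnits (Fin N)) R₁ R₂ (f j)).Cfg, (bg9YR (Matrix (Fin N) (Fin N) ℂ) (specialUnitaryUnits (Fin N)) R₁ R₂ (f j)).Reg335 c α₀ U →
      Proj349Maj (g := geo9Y (f j)) (blkSK (f j).toKIdx (sIK (f j).toKIdx (bI (f j)))) (blkBK (f j).toKIdx (bI (f j)))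
        (PcoK (f j).toKIdx (trBasis N) (bg9YR (Matrix (Fin N) (Fin N) ℂ) (specialUnitaryUnits (Fin N)) R₁ R₂ (f j)) (fun U => U) (parS (f j)) (Gp (f j)) U)
        (DvcoKH (f j).toKIdx (trBasis N) (bg9YR (Matrix (Fin N) (Fin N) ℂ) (specialUnitaryUnits (Fin N)) R₁ R₂ (f j)) (fun U => U) U) (DvscoKH (f j).toKIdx (trBasis N) (bg9YR (Matrix (Fin N) (Fin N) ℂ) (specialUnitaryUnits (Fin N)) R₁ R₂ (f j)) (fun U => U) U) 1 (H (f j)) CP δP)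
    (h43 : ∀ x : MemberY d ℓ hd hL b₀ b₁ Mstar, letI : Fintype (geo9K x.toKIdx).Site := (inferInstance : Fintype (geo9Y x).Site); M₀ ≤ (geo9Y x).M → ∀ α₀ : ℝ, 0 < α₀ → (geo9Y x).M * α₀ ≤ a₀ → ∀ U : (bg9YR (Matrix (Fin N) (Fin N) ℂ) (specialUnitaryUnits (Fin N)) R₁ R₂ x).Cfg, (bg9YR (Matrix (Fin N) (Fin N) ℂ) (specialUnitaryUnits (Fin N)) R₁ R₂ x).Reg335 c α₀ U →
      (bg9YR (Matrix (Fin N) (Fin N) ℂ) (specialUnitaryUnits (Fin N)) R₁ R₂ x).Reg336 c α₀ U →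
        HasMaj (cNorm 1 (H x) (𝔬12 x).blk (fun y => (geo9Y_len_pos x y).le) 0) (bH13 x U)
          (GcoS x.toKIdx (trBasis N) (bg9YR (Matrix (Fin N) (Fin N) ℂ) (specialUnitaryUnits (Fin N)) R₁ R₂ x) (fun U => U) (GpY x.toKIdx (parT x.toKIdx)) U ∘ₗ DvscoKH x.toKIdx (trBasis N) (bg9YR (Matrix (Fin N) (Fin N) ℂ) (specialUnitaryUnits (Fin N)) R₁ R₂ x) (fun U => U) U)
          (fun a a' => B43 * Real.exp (-(δ43 * (geo9Y x).dist a a'))))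
:
    ∃ MT : ℝ, ∀ j : J, letI : Fintype (geo9K (f j).toKIdx).Site := (inferInstance : Fintype (geo9Y (f j)).Site); MT ≤ (geo9Y (f j)).M → ∀ α₀ : ℝ, 0 < α₀ → (geo9Y (f j)).M * α₀ ≤ a₀ → ∀ U : (bg9YR (Matrix (Fin N) (Fin N) ℂ) (specialUnitaryUnits (Fin N)) R₁ R₂ (f j)).Cfg, (bg9YR (Matrix (Fin N) (Fin N) ℂ) (specialUnitaryUnits (Fin N)) R₁ R₂ (f j)).Reg335 c α₀ U →
      (bg9YR (Matrix (Fin N) (Fin N) ℂ) (specialUnitaryUnits (Fin N)) R₁ R₂ (f j)).Reg336 c α₀ U → CurrentMaj (𝔬12 (f j)).blkW (𝔬12 (f j)).blk (BcoKH (f j).toKIdx (trBasis N) (bg9YR (Matrix (Fin N) (Fin N) ℂ) (specialUnitaryUnits (Fin N)) R₁ R₂ (f j)) (fun U => U) U) (BdcoKH (f j).toKIdx (trBasis N) (bg9YR (Matrix (Fin N) (Fin N) ℂ) (specialUnitaryUnits (Fin N)) R₁ R₂ (f j)) (fun U => U) U) 1 (H (f j)) (tJ * ((geo9Y (f j)).M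 * α₀)) δB →
      HasMaj (cNorm 1 (H (f j)) (𝔬12 (f j)).blk (fun y => (geo9Y_len_pos (f j) y).le) 2) (cNorm 1 (H (f j)) (𝔬12 (f j)).blk (fun y => (geo9Y_len_pos (f j) y).le) 0) (TaLcoK (f j).toKIdx (trBasis N) (bg9YR (Matrix (Fin N) (Fin N) ℂ) (specialUnitaryUnits (Fin N)) R₁ R₂ (f j)) (fun U => U) (parT (f j).toKIdx) (GpPhysY (f j).toKIdx (parT (f j).toKIdx)) U) (fun a a' => tA * ((geo9Y (f j)).M * α₀) * Real.exp (-(δT * (geo9Y (f j)).dist a a'))) →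
        HasMaj (cNorm 1 (H (f j)) (𝔬12 (f j)).blk (fun y => (geo9Y_len_pos (f j) y).le) 2) (bH13 (f j) U)
          (TbLcoKH (f j).toKIdx (trBasis N) (bg9YR (Matrix (Fin N) (Fin N) ℂ) (specialUnitaryUnits (Fin N)) R₁ R₂ (f j)) (fun U => U) (parT (f j).toKIdx) (GpPhysY (f j).toKIdx (parT (f j).toKIdx)) U)
          (fun a a' => t₂ * ((geo9Y (f j)).M * α₀) * Real.exp (-(ρ * (geo9Y (f j)).dist a a'))) := by
  obtain ⟨Mg, hFa⟩ := facts347_exp261_geo9Y (d := d) (ℓ := ℓ) (hd := hd) (hL := hL) (b₀ := b₀) (b₁ := b₁) (Mstar := Mstar) H (α := 1 / 2) (δ := 2 * τ)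
    (by norm_num) (by norm_num) (by linarith)
  obtain ⟨ML, hrow⟩ := rowConst261_spec_of_rowSum261 (rowSum261_geo9Y (d := d) (ℓ := ℓ) (hd := hd) (hL := hL) (b₀ := b₀) (b₁ := b₁) (Mstar := Mstar)) hσ
  have hc0 : (0 : ℝ) ≤ rowConst261 (@geo9Y d ℓ hd hL b₀ b₁ Mstar) σ := rowConst261_nonneg _ _
  have hτ' : 0 ≤ 1 / 2 * (2 * τ) := by linarith
  have hbud' : ρ + σ + 1 / 2 * (2 * τ) ≤ r := by linarith
  refine ⟨max M₀ (max Mg ML), fun j hM α₀ hα ha U hU hU' hBJx htax => ?_⟩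
  letI : Fintype (geo9K (f j).toKIdx).Site := (inferInstance : Fintype (geo9Y (f j)).Site)
  have hM0 : M₀ ≤ (geo9Y (f j)).M := (le_max_left _ _).trans hM
  have hrowx : RowSum (toB6 (geo9Y (f j)) 1 (H (f j))) σ (rowConst261 (@geo9Y d ℓ hd hL b₀ b₁ Mstar) σ) := fun y => hrow (f j) (((le_max_right _ _).trans (le_max_right _ _)).trans hM) y
  have hFax := hFa (f j) (((le_max_left _ _).trans (le_max_right _ _)).trans hM)
  have hG : GeoOK (geo9Y (f j)) := ⟨geo9Y_dist_triangle (f j), geo9Y_dist_comm (f j), geo9K_dist_nonneg (f j).toKIdx, geo9Y_len_pos (f j)⟩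
  have hN : 0 < N := Nat.pos_of_ne_zero (NeZero.ne N)
  have hcR : 0 < cR39 (trBasis N) := cR39_trBasis_pos hN
  have hθ : 0 ≤ (geo9Y (f j)).M * α₀ := mul_nonneg (hM₀.trans hM0) hα.le
  have h49' : Proj349Maj (𝔬12 (f j)).blkW (𝔬12 (f j)).blk
      (PcoK (f j).toKIdx (trBasis N) (bg9YR (Matrix (Fin N) (Fin N) ℂ) (specialUnitaryUnits (Fin N)) R₁ R₂ (f j)) (fun U => U) (parT (f j).toKIdx) (GpY (f j).toKIdx (parT (f j).toKIdx)) U)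
      (DvcoKH (f j).toKIdx (trBasis N) (bg9YR (Matrix (Fin N) (Fin N) ℂ) (specialUnitaryUnits (Fin N)) R₁ R₂ (f j)) (fun U => U) U) (DvscoKH (f j).toKIdx (trBasis N) (bg9YR (Matrix (Fin N) (Fin N) ℂ) (specialUnitaryUnits (Fin N)) R₁ R₂ (f j)) (fun U => U) U) 1 (H (f j)) CP δP := by
    rw [hblkW12 (f j), hblk12 (f j), ← hGp (f j), ← hparS (f j)]
    exact h49 j hM0 α₀ hα ha U hU
  have h31' : Thm31GpMaj (𝔬12 (f j)).blkW (𝔬12 (f j)).blk (GcoS (f j).toKIdx (trBasis N) (bg9YR (Matrix (Fin N) (Fin N) ℂ) (specialUnitaryUnits (Fin N)) R₁ R₂ (f j)) (fun U => U) (GpY (f j).toKIdx (parT (f j).toKIdx)) U)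
      (DvcoKH (f j).toKIdx (trBasis N) (bg9YR (Matrix (Fin N) (Fin N) ℂ) (specialUnitaryUnits (Fin N)) R₁ R₂ (f j)) (fun U => U) U) (DvscoKH (f j).toKIdx (trBasis N) (bg9YR (Matrix (Fin N) (Fin N) ℂ) (specialUnitaryUnits (Fin N)) R₁ R₂ (f j)) (fun U => U) U) 1 (H (f j)) B₀ δ₀ := by
    rw [hblkW12 (f j), hblk12 (f j), ← hGp (f j)]
    exact h31 (f j) hM0 α₀ hα ha U hU
  have h43x := h43 (f j) hM0 α₀ hα ha U hU hU'
  rw [hbH13 (f j) U] at h43x ⊢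
  have h31'' := h31'; have h49'' := h49'
  rw [hblkW12 (f j), hblk12 (f j)] at h31'' h49'' hBJx
  rw [hblk12 (f j)] at h43x htax
  have h := tbH_pins_print_of_h43 (f j).toKIdx (trBasis N) (bg9YR (Matrix (Fin N) (Fin N) ℂ) (specialUnitaryUnits (Fin N)) R₁ R₂ (f j)) (fun U => U) (parT (f j).toKIdx)
    w13 hw13₀ hw13₁ hG hFax hrowx hcR (hβ1 (f j)) (hlev (f j)) (abs_cf_eq_nKT (f j).toKIdx (f j).hcfk) (links_le_one hGR (f j) hU) h31'' h49'' hBJx h43x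
    htax hB₀ hCP htJ hθ hB43 htA hc0 hσ.le hτ' hr₀ hrP hrB hρ hρT hbud' hbud43
  rw [← hblk12 (f j)] at h
  -- the member's `L ≤ ℓ + 1` into the closed constant (the two fields separately, `hasMaj_weaken` at the same rate)
  have hLx : (geo9Y (f j)).L ≤ (((ℓ + 1 : ℕ) : ℝ)) := (geo9Y_scalars (f j)).2.1
  have hL0 : 0 ≤ (geo9Y (f j)).L := le_trans zero_le_one hFax.one_le_L
  have hi : 0 ≤ (cR39 (trBasis N))⁻¹ := inv_nonneg.2 hcR.le
  have hJ0 : 0 ≤ (B₀ * (geo9Y (f j)).L * ((cR39 (trBasis N))⁻¹ * (tJ * (geo9Y (f j)).L ^ 2)) * rowConst261 (@geo9Y d ℓ hd hL b₀ b₁ Mstar) σ) := by positivity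
  have hJJ : (B₀ * (geo9Y (f j)).L * ((cR39 (trBasis N))⁻¹ * (tJ * (geo9Y (f j)).L ^ 2)) * rowConst261 (@geo9Y d ℓ hd hL b₀ b₁ Mstar) σ) ≤ (B₀ * (((ℓ + 1 : ℕ) : ℝ)) * ((cR39 (trBasis N))⁻¹ * (tJ * (((ℓ + 1 : ℕ) : ℝ)) ^ 2)) * rowConst261 (@geo9Y d ℓ hd hL b₀ b₁ Mstar) σ) := by gcongr
  have hKJ0 : 0 ≤ (CP * (geo9Y (f j)).L * (B₀ * (geo9Y (f j)).L * ((cR39 (trBasis N))⁻¹ * (tJ * (geo9Y (f j)).L ^ 2)) * rowConst261 (@geo9Y d ℓ hd hL b₀ b₁ Mstar) σ) * rowConst261 (@geo9Y d ℓ hd hL b₀ b₁ Mstar) σ) := by positivity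
  have hKJJ : (CP * (geo9Y (f j)).L * (B₀ * (geo9Y (f j)).L * ((cR39 (trBasis N))⁻¹ * (tJ * (geo9Y (f j)).L ^ 2)) * rowConst261 (@geo9Y d ℓ hd hL b₀ b₁ Mstar) σ) * rowConst261 (@geo9Y d ℓ hd hL b₀ b₁ Mstar) σ) ≤ (CP * (((ℓ + 1 : ℕ) : ℝ)) * (B₀ * (((ℓ + 1 : ℕ) : ℝ)) * ((cR39 (trBasis N))⁻¹ * (tJ * (((ℓ + 1 : ℕ) : ℝ)) ^ 2)) * rowConst261 (@geo9Y d ℓ hd hL b₀ b₁ Mstar) σ) * rowConst261 (@geo9Y d ℓ hd hL b₀ b₁ Mstar) σ) := by gcongr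
  have hK0 : 0 ≤ (CP * (geo9Y (f j)).L * (B₀ * ((cR39 (trBasis N))⁻¹ * tA) * rowConst261 (@geo9Y d ℓ hd hL b₀ b₁ Mstar) σ) * rowConst261 (@geo9Y d ℓ hd hL b₀ b₁ Mstar) σ) := by positivity
  have hKK : (CP * (geo9Y (f j)).L * (B₀ * ((cR39 (trBasis N))⁻¹ * tA) * rowConst261 (@geo9Y d ℓ hd hL b₀ b₁ Mstar) σ) * rowConst261 (@geo9Y d ℓ hd hL b₀ b₁ Mstar) σ) ≤ (CP * (((ℓ + 1 : ℕ) : ℝ)) * (B₀ * ((cR39 (trBasis N))⁻¹ * tA) * rowConst261 (@geo9Y d ℓ hd hL b₀ b₁ Mstar) σ) * rowConst261 (@geo9Y d ℓ hd hL b₀ b₁ Mstar) σ) := by gcongr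
  have hKHle : ((CTel d ℓ (trBasis N) ρ (B₀ * (geo9Y (f j)).L * ((cR39 (trBasis N))⁻¹ * (tJ * (geo9Y (f j)).L ^ 2)) * rowConst261 (@geo9Y d ℓ hd hL b₀ b₁ Mstar) σ) (B₀ * (geo9Y (f j)).L * ((cR39 (trBasis N))⁻¹ * (tJ * (geo9Y (f j)).L ^ 2)) * rowConst261 (@geo9Y d ℓ hd hL b₀ b₁ Mstar) σ) + CTel d ℓ (trBasis N) ρ (CP * (geo9Y (f j)).L * (B₀ * (geo9Y (f j)).L * ((cR39 (trBasis N))⁻¹ * (tJ * (geo9Y (f j)).L ^ 2)) * rowConst261 (@geo9Y d ℓ hd hL b₀ b₁ Mstar) σ) * rowConst261 (@geo9Y d ℓ hd hL b₀ b₁ Mstar) σ) (CP * (geo9Y (f j)).L * (B₀ * (geo9Y (f j)).L * ((cR39 (trBasis N))⁻¹ * (tJ * (geo9Y (f j)).L ^ 2)) * rowConst261 (@geo9Y d ℓ hd hL b₀ b₁ Mstar) σ) * rowConst261 (@geo9Y d ℓ hd hL b₀ b₁ Mstar) σ)) + (B43 * ((cR39 (trBasis N))⁻¹ * tA) * rowConst261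 (@geo9Y d ℓ hd hL b₀ b₁ Mstar) σ + CTel d ℓ (trBasis N) ρ (CP * (geo9Y (f j)).L * (B₀ * ((cR39 (trBasis N))⁻¹ * tA) * rowConst261 (@geo9Y d ℓ hd hL b₀ b₁ Mstar) σ) * rowConst261 (@geo9Y d ℓ hd hL b₀ b₁ Mstar) σ) (CP * (geo9Y (f j)).L * (B₀ * ((cR39 (trBasis N))⁻¹ * tA) * rowConst261 (@geo9Y d ℓ hd hL b₀ b₁ Mstar) σ) * rowConst261 (@geo9Y d ℓ hd hL b₀ b₁ Mstar) σ)) + (B43 * ((cR39 (trBasis N))⁻¹ * tA) * rowConst261 (@geo9Y d ℓ hd hL b₀ b₁ Mstar) σ + CTel d ℓ (trBasis N) ρ (CP * (geo9Y (f j)).L * (B₀ * ((cR39 (trBasis N))⁻¹ * tA) * rowConst261 (@geo9Y d ℓ hd hL b₀ b₁ Mstar) σ) * rowConst261 (@geo9Y d ℓ hd hL b₀ b₁ Mstar) σ) (CP * (geo9Y (f j)).L * (B₀ * ((cR39 (trBasis N))⁻¹ * tA) * rowConst261 (@geo9Y d ℓ hd hL b₀ b₁ Mstar) σ) * rowConst261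 (@geo9Y d ℓ hd hL b₀ b₁ Mstar) σ))) * ((geo9Y (f j)).M * α₀) ≤ ((CTel d ℓ (trBasis N) ρ (B₀ * (((ℓ + 1 : ℕ) : ℝ)) * ((cR39 (trBasis N))⁻¹ * (tJ * (((ℓ + 1 : ℕ) : ℝ)) ^ 2)) * rowConst261 (@geo9Y d ℓ hd hL b₀ b₁ Mstar) σ) (B₀ * (((ℓ + 1 : ℕ) : ℝ)) * ((cR39 (trBasis N))⁻¹ * (tJ * (((ℓ + 1 : ℕ) : ℝ)) ^ 2)) * rowConst261 (@geo9Y d ℓ hd hL b₀ b₁ Mstar) σ) + CTel d ℓ (trBasis N) ρ (CP * (((ℓ + 1 : ℕ) : ℝ)) * (B₀ * (((ℓ + 1 : ℕ) : ℝ)) * ((cR39 (trBasis N))⁻¹ * (tJ * (((ℓ + 1 : ℕ) : ℝ)) ^ 2)) * rowConst261 (@geo9Y d ℓ hd hL b₀ b₁ Mstar) σ) * rowConst261 (@geo9Y d ℓ hd hL b₀ b₁ Mstar) σ) (CP * (((ℓ + 1 : ℕ) : ℝ)) * (B₀ * (((ℓ + 1 : ℕ) : ℝ)) * ((cR39 (trBasis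 N))⁻¹ * (tJ * (((ℓ + 1 : ℕ) : ℝ)) ^ 2)) * rowConst261 (@geo9Y d ℓ hd hL b₀ b₁ Mstar) σ) * rowConst261 (@geo9Y d ℓ hd hL b₀ b₁ Mstar) σ)) + (B43 * ((cR39 (trBasis N))⁻¹ * tA) * rowConst261 (@geo9Y d ℓ hd hL b₀ b₁ Mstar) σ + CTel d ℓ (trBasis N) ρ (CP * (((ℓ + 1 : ℕ) : ℝ)) * (B₀ * ((cR39 (trBasis N))⁻¹ * tA) * rowConst261 (@geo9Y d ℓ hd hL b₀ b₁ Mstar) σ) * rowConst261 (@geo9Y d ℓ hd hL b₀ b₁ Mstar) σ) (CP * (((ℓ + 1 : ℕ) : ℝ)) * (B₀ * ((cR39 (trBasis N))⁻¹ * tA) * rowConst261 (@geo9Y d ℓ hd hL b₀ b₁ Mstar) σ) * rowConst261 (@geo9Y d ℓ hd hL b₀ b₁ Mstar) σ)) + (B43 * ((cR39 (trBasis N))⁻¹ * tA) * rowConst261 (@geo9Y d ℓ hd hL b₀ b₁ Mstar) σ + CTel d ℓ (trBasis N) ρ (CP * (((ℓ + 1 : ℕ) : ℝ)) * (B₀ *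 ((cR39 (trBasis N))⁻¹ * tA) * rowConst261 (@geo9Y d ℓ hd hL b₀ b₁ Mstar) σ) * rowConst261 (@geo9Y d ℓ hd hL b₀ b₁ Mstar) σ) (CP * (((ℓ + 1 : ℕ) : ℝ)) * (B₀ * ((cR39 (trBasis N))⁻¹ * tA) * rowConst261 (@geo9Y d ℓ hd hL b₀ b₁ Mstar) σ) * rowConst261 (@geo9Y d ℓ hd hL b₀ b₁ Mstar) σ))) * ((geo9Y (f j)).M * α₀) := by
    apply mul_le_mul_of_nonneg_right _ hθ
    have h1 := CTel_mono (d := d) (ℓ := ℓ) (trBasis N) (δ := ρ) hJJ hJJ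
    have h2 := CTel_mono (d := d) (ℓ := ℓ) (trBasis N) (δ := ρ) hKJJ hKJJ
    have h3 := CTel_mono (d := d) (ℓ := ℓ) (trBasis N) (δ := ρ) hKK hKK
    linarith
  have hKHnn : 0 ≤ ((CTel d ℓ (trBasis N) ρ (B₀ * (geo9Y (f j)).L * ((cR39 (trBasis N))⁻¹ * (tJ * (geo9Y (f j)).L ^ 2)) * rowConst261 (@geo9Y d ℓ hd hL b₀ b₁ Mstar) σ) (B₀ * (geo9Y (f j)).L * ((cR39 (trBasis N))⁻¹ * (tJ * (geo9Y (f j)).L ^ 2)) * rowConst261 (@geo9Y d ℓ hd hL b₀ b₁ Mstar) σ) + CTel d ℓ (trBasis N) ρ (CP * (geo9Y (f j)).L * (B₀ * (geo9Y (f j)).L * ((cR39 (trBasis N))⁻¹ * (tJ * (geo9Y (f j)).L ^ 2)) * rowConst261 (@geo9Y d ℓ hd hL b₀ b₁ Mstar) σ) * rowConst261 (@geo9Y d ℓ hd hL b₀ b₁ Mstar) σ) (CP * (geo9Y (f j)).L * (B₀ * (geo9Y (f j)).L * ((cR39 (trBasis N))⁻¹ * (tJ * (geo9Y (f j)).L ^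 2)) * rowConst261 (@geo9Y d ℓ hd hL b₀ b₁ Mstar) σ) * rowConst261 (@geo9Y d ℓ hd hL b₀ b₁ Mstar) σ)) + (B43 * ((cR39 (trBasis N))⁻¹ * tA) * rowConst261 (@geo9Y d ℓ hd hL b₀ b₁ Mstar) σ + CTel d ℓ (trBasis N) ρ (CP * (geo9Y (f j)).L * (B₀ * ((cR39 (trBasis N))⁻¹ * tA) * rowConst261 (@geo9Y d ℓ hd hL b₀ b₁ Mstar) σ) * rowConst261 (@geo9Y d ℓ hd hL b₀ b₁ Mstar) σ) (CP * (geo9Y (f j)).L * (B₀ * ((cR39 (trBasis N))⁻¹ * tA) * rowConst261 (@geo9Y d ℓ hd hL b₀ b₁ Mstar) σ) * rowConst261 (@geo9Y d ℓ hd hL b₀ b₁ Mstar) σ)) + (B43 * ((cR39 (trBasis N))⁻¹ * tA) * rowConst261 (@geo9Y d ℓ hd hL b₀ b₁ Mstar) σ + CTel d ℓ (trBasis N) ρ (CP * (geo9Y (f j)).L * (B₀ * ((cR39 (trBasis N))⁻¹ * tA) * rowConst261 (@geo9Y d ℓ hd hL b₀ b₁ Mstar) σ) * rowConst261 (@geo9Y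 d ℓ hd hL b₀ b₁ Mstar) σ) (CP * (geo9Y (f j)).L * (B₀ * ((cR39 (trBasis N))⁻¹ * tA) * rowConst261 (@geo9Y d ℓ hd hL b₀ b₁ Mstar) σ) * rowConst261 (@geo9Y d ℓ hd hL b₀ b₁ Mstar) σ))) * ((geo9Y (f j)).M * α₀) := by
    have h1 := CTel_nonneg (d := d) (ℓ := ℓ) (trBasis N) (δ := ρ) hJ0 hJ0
    have h2 := CTel_nonneg (d := d) (ℓ := ℓ) (trBasis N) (δ := ρ) hKJ0 hKJ0
    have h3 := CTel_nonneg (d := d) (ℓ := ℓ) (trBasis N) (δ := ρ) hK0 hK0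
    have h4 : 0 ≤ B43 * ((cR39 (trBasis N))⁻¹ * tA) * rowConst261 (@geo9Y d ℓ hd hL b₀ b₁ Mstar) σ := by positivity
    positivity
  have ht₂θ := hKHle.trans (mul_le_mul_of_nonneg_right ht₂ hθ)
  have hX0 : 0 ≤ B43 * ((cR39 (trBasis N))⁻¹ * tA) * rowConst261 (@geo9Y d ℓ hd hL b₀ b₁ Mstar) σ + CTel d ℓ (trBasis N) ρ (CP * (geo9Y (f j)).L * (B₀ * ((cR39 (trBasis N))⁻¹ * tA) * rowConst261 (@geo9Y d ℓ hd hL b₀ b₁ Mstar) σ) * rowConst261 (@geo9Y d ℓ hd hL b₀ b₁ Mstar) σ) (CP * (geo9Y (f j)).L * (B₀ * ((cR39 (trBasis N))⁻¹ * tA) * rowConst261 (@geo9Y d ℓ hd hL b₀ b₁ Mstar) σ) * rowConst261 (@geo9Y d ℓ hd hL b₀ b₁ Mstar) σ) := by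
    have h3 := CTel_nonneg (d := d) (ℓ := ℓ) (trBasis N) (δ := ρ) hK0 hK0
    positivity
  have hK1nn : 0 ≤ ((CTel d ℓ (trBasis N) ρ (B₀ * (geo9Y (f j)).L * ((cR39 (trBasis N))⁻¹ * (tJ * (geo9Y (f j)).L ^ 2)) * rowConst261 (@geo9Y d ℓ hd hL b₀ b₁ Mstar) σ) (B₀ * (geo9Y (f j)).L * ((cR39 (trBasis N))⁻¹ * (tJ * (geo9Y (f j)).L ^ 2)) * rowConst261 (@geo9Y d ℓ hd hL b₀ b₁ Mstar) σ) + CTel d ℓ (trBasis N) ρ (CP * (geo9Y (f j)).L * (B₀ * (geo9Y (f j)).L * ((cR39 (trBasis N))⁻¹ * (tJ * (geo9Y (f j)).L ^ 2)) * rowConst261 (@geo9Y d ℓ hd hL b₀ b₁ Mstar) σ) * rowConst261 (@geo9Y d ℓ hd hL b₀ b₁ Mstar) σ) (CP * (geo9Y (f j)).L * (B₀ * (geo9Y (f j)).L * ((cR39 (trBasis N))⁻¹ * (tJ * (geo9Y (f j)).L ^ 2)) * rowConst261 (@geo9Y d ℓ hd hL b₀ b₁ Mstar) σ) * rowConst261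 (@geo9Y d ℓ hd hL b₀ b₁ Mstar) σ)) + (B43 * ((cR39 (trBasis N))⁻¹ * tA) * rowConst261 (@geo9Y d ℓ hd hL b₀ b₁ Mstar) σ + CTel d ℓ (trBasis N) ρ (CP * (geo9Y (f j)).L * (B₀ * ((cR39 (trBasis N))⁻¹ * tA) * rowConst261 (@geo9Y d ℓ hd hL b₀ b₁ Mstar) σ) * rowConst261 (@geo9Y d ℓ hd hL b₀ b₁ Mstar) σ) (CP * (geo9Y (f j)).L * (B₀ * ((cR39 (trBasis N))⁻¹ * tA) * rowConst261 (@geo9Y d ℓ hd hL b₀ b₁ Mstar) σ) * rowConst261 (@geo9Y d ℓ hd hL b₀ b₁ Mstar) σ))) * ((geo9Y (f j)).M * α₀) := by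
    have h1 := CTel_nonneg (d := d) (ℓ := ℓ) (trBasis N) (δ := ρ) hJ0 hJ0
    have h2 := CTel_nonneg (d := d) (ℓ := ℓ) (trBasis N) (δ := ρ) hKJ0 hKJ0
    positivity
  have hK1le := (mul_le_mul_of_nonneg_right (le_add_of_nonneg_right hX0) hθ).trans ht₂θ
  exact hasMaj_weaken hG hK1nn hK1le le_rfl h

end Summit.QuantumFields.YangMills.BalabanUVNodes.N06TbHLegAtPinsPhysPUParJ
end
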